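import Literature.NumberTheory.Automorphic.ShimuraCurveHeckeSimultaneousEigenformsProofs
import Literature.NumberTheory.Automorphic.ShimuraCurveMapDegreeProofs
import Literature.NumberTheory.Automorphic.ShimuraParametrizationSplitCaseConverseProofs
import HarnessLib

/-!
# Periods of weight-two forms on `X₀^D(M)`: the period homomorphism, its injectivity, Hecke
stability of period groups, and integrality of Hecke eigenvalues (`D > 1`)

Infrastructure towards the named fact
`Literature.NumberTheory.Automorphic.nonempty_shimuraParametrizationData` (H. Pasten, *Shimura
curves and the abc conjecture*, §2 p. 12 with §4.9–4.11: the Jacquet–Langlands/Shimura-construction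
datum of an elliptic curve on `X₀^D(M)`), whose conclusion `ShimuraParametrizationData X W` is
phrased through the PERIODS of a weight-two form (`HasPeriodsIn X.Gamma form Λ_L`) and its Hecke
eigenvalues (`X.heckeFun ℓ form = a_ℓ(W) form`). This file supplies the first layer of the
Eichler–Shimura theory behind §4.9/§4.11 — Shimura, *Introduction to the arithmetic theory of
automorphic functions* (1971), Ch. 8 — for the groups `Γ₀^D(M) = ι(O¹)` of the tree
(`ShimuraCurveData.Gamma`), entirely as theorems (zero debt: no `def`, no new named fact):

1. `group_fg_of_isCompact_of_forall_exists_smul_mem`, `ShimuraCurveData.fg_Gamma` — **`Γ₀^D(M)` is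
   finitely generated** for `D > 1` (Shimura Prop. 8.6, proof: "The group `Γ` has a finite set of
   generators"): a group acting properly discontinuously on `ℍ` with a compact set meeting every
   orbit is generated by the finitely many elements moving a compact neighbourhood of that set onto
   itself (`ℍ` is connected).
2. `segmentIntegral_smul_smul_of_mem`, `period_eq_period`, `period_mul`, `period_one`, `period_inv`,
   `hasPeriodsIn_of_basePoint` — **the period homomorphism** `γ ↦ ∫_τ^{γτ} h` of `h ∈ S₂(Γ)`,
   `Γ ≤ SL₂(ℝ)` (Shimura §8.2, (8.2.19)–(8.2.20) with `n = 0`): independent of `τ`, additive.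
3. `coe_eq_zero_of_forall_re_period_eq_zero` (+ `_of_forall_period_eq_zero`, and for data `X` with
   `D > 1`: `ShimuraCurveData.coe_eq_zero_of_forall_re_period_eq_zero`) — **injectivity of the
   period map** (Shimura Thm. 8.4, injectivity half): for cocompact `Γ`, a cusp form all of whose
   periods are purely imaginary is `0`. (Shimura argues with the non-degenerate pairing `A(f, g)`;
   in weight `2` the maximum principle for `exp ∘ ∫h` on the compact quotient is shorter.)
4. `ShimuraCurveData.hasPeriodsIn_heckeFun` — **Hecke stability of period groups** (Shimura §8.3,
   (8.3.2): double cosets act on `H¹(Γ, ·)` compatibly with the periods): if the periods of `h` lie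
   in an additive subgroup `Λ ⊆ ℂ`, so do the periods of `T_n h`, for every `n`.
5. `ShimuraCurveData.isIntegral_of_heckeFun_eq_mul` — **Hecke eigenvalues on `S₂^D(M)` are algebraic
   integers** (`D > 1`; Pasten §4.9: "Such a `χ` takes values in the ring of integers of a totally
   real number field" — here: each `χ(T_n)` is an algebraic integer, and it is real by the tree's
   `conj_eq_of_heckeFun_eq_mul`; `isIntegral_and_conj_eq_of_heckeFun_eq_mul`): the period group of
   an eigenform `h ≠ 0` is a non-zero (3.) finitely generated (1.) `ℤ`-module stable under the
   eigenvalue (4.). Rational eigenvalues are therefore integers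
   (`exists_intCast_eq_of_heckeFun_eq_mul`), as the `a_ℓ(W)` of a parametrisation datum must be;
   and when `S₂^D(M) ≠ 0` a non-zero simultaneous `T_p`-eigenform with real algebraic-integer
   eigenvalues exists (`exists_simultaneous_heckeFun_eigenform_isIntegral`, with the tree's
   `exists_simultaneous_heckeFun_eigenform` of `ShimuraCurveHeckeSimultaneousEigenformsProofs`).

Nothing here reduces the fact itself (it stays parked on the Modularity theorem
`Literature.NumberTheory.EllipticCurves.ModularForms.exists_isNewformOf`, with the Jacquet–Langlands
transfer and Shimura's construction for `D > 1`); these are the period-side prerequisites of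
Shimura's construction `q_{[χ]}` (§4.11), in the tree's own vocabulary `segmentIntegral` /
`HasPeriodsIn` / `heckeFun`.

## References

* H. Pasten, *Shimura curves and the abc conjecture*, J. Number Theory 254 (2024) 214–335 =
  arXiv:1705.09251, §4.9 (systems of Hecke eigenvalues), §4.11, §2 p. 12. [PastenShimura2024]
* G. Shimura, *Introduction to the arithmetic theory of automorphic functions* (1971), §8.2
  (8.2.19)–(8.2.20), Thm. 8.4, §8.3 (8.3.2), Prop. 8.6. [ShimuraIATAF1971]

Tree: `exists_hasDerivAt_primitive`, `segmentIntegral_eq_sub`, `segmentIntegral_sub_segmentIntegral`,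
`hasDerivAt_segmentIntegral` (`ShimuraCurveDegreeFormulaProofs`); `segmentIntegral_slash_eq`,
`hasDerivAt_comp_smul_of_hasDerivAt` (`ShimuraParametrizationSplitCaseConverseProofs`);
`properlyDiscontinuousSMul_Gamma` (`ShimuraCurveMapDegreeProofs`);
`exists_forall_exists_smul_mem_closedBall` (`ShimuraCurveFiniteVolume`); `heckeFun_eq_sum`,
`finite_quotient_heckeSetoid`, `exists_cuspForm_coe_eq_heckeFun`, `mul_mem_heckeSet`
(`ShimuraCurveHeckeOperatorProofs`); `det_pos_of_mem_heckeSet`, `conj_eq_of_heckeFun_eq_mul`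
(`ShimuraCurveHeckeSelfAdjointProofs`); `exists_simultaneous_heckeFun_eigenform`
(`ShimuraCurveHeckeSimultaneousEigenformsProofs`). Mathlib: `Complex.eqOn_of_isPreconnected_of_isMaxOn_norm`,
`isIntegral_of_smul_mem_submodule`, `ProperlyDiscontinuousSMul.finite_disjoint_inter_image`,
`Group.fg_iff`, `IsIntegrallyClosed.isIntegral_iff`.
-/

noncomputable section

open scoped MatrixGroups ModularForm Topology Pointwise
open UpperHalfPlane Filter Set Function

namespace Literature.NumberTheory.Automorphic

/-! ### 1. Finite generation of cocompact properly discontinuous groups -/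

section FiniteGeneration

/-- **A cocompact properly discontinuous group on `ℍ` is finitely generated** (Shimura 1971,
Prop. 8.6, proof: "The group `Γ` has a finite set of generators"; Siegel). If `Γ ≤ GL(2, ℝ)` acts
properly discontinuously on `ℍ` and a compact `K` meets every orbit, then `Γ` is generated by the
finitely many `γ` with `γ K' ∩ K' ≠ ∅`, `K' ⊇ K` a compact ball: the union of the translates of an
open ball `V`, `K ⊆ V ⊆ K'`, by the subgroup they generate and the union of the remaining translates
are disjoint open sets covering the connected space `ℍ`. [cite: ShimuraIATAF1971, Prop. 8.6 (proof)] -/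
theorem group_fg_of_isCompact_of_forall_exists_smul_mem {Γ : Subgroup (GL (Fin 2) ℝ)}
    [ProperlyDiscontinuousSMul Γ ℍ] {K : Set ℍ} (hK : IsCompact K)
    (hcov : ∀ τ : ℍ, ∃ γ ∈ Γ, γ • τ ∈ K) : Group.FG Γ := by
  classical
  obtain ⟨R, hR0, hR⟩ := hK.isBounded.subset_closedBall_lt 0 UpperHalfPlane.I
  set V : Set ℍ := Metric.ball UpperHalfPlane.I (R + 1) with hV
  set K' : Set ℍ := Metric.closedBall UpperHalfPlane.I (R + 1) with hK'def
  have hK' : IsCompact K' := isCompact_closedBall _ _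
  have hVK' : V ⊆ K' := Metric.ball_subset_closedBall
  have hKV : K ⊆ V := hR.trans (Metric.closedBall_subset_ball (by linarith))
  have hVopen : IsOpen V := Metric.isOpen_ball
  have hIV : UpperHalfPlane.I ∈ V := Metric.mem_ball_self (by linarith)
  -- the finite generating set
  set S : Set Γ := {γ : Γ | ((fun x : ℍ => γ • x) '' K' ∩ K').Nonempty} with hSdef
  have hSfin : S.Finite := ProperlyDiscontinuousSMul.finite_disjoint_inter_image hK' hK'
  refine Group.fg_iff.mpr ⟨S, ?_, hSfin⟩
  set H : Subgroup Γ := Subgroup.closure S with hHdef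
  -- two translates of `V` by `δ₁ ∈ H` and `δ₂` meet only if `δ₂ ∈ H`
  have key : ∀ δ₁ δ₂ : Γ, δ₁ ∈ H →
      (((δ₁ : GL (Fin 2) ℝ) • V) ∩ ((δ₂ : GL (Fin 2) ℝ) • V)).Nonempty → δ₂ ∈ H := by
    rintro δ₁ δ₂ h₁ ⟨x, hx₁, hx₂⟩
    obtain ⟨v₁, hv₁, rfl⟩ := Set.mem_smul_set.mp hx₁
    obtain ⟨v₂, hv₂, he⟩ := Set.mem_smul_set.mp hx₂
    have hmem : δ₁⁻¹ * δ₂ ∈ S := by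
      refine ⟨v₁, ⟨v₂, hVK' hv₂, ?_⟩, hVK' hv₁⟩
      show ((δ₁⁻¹ * δ₂ : Γ) : GL (Fin 2) ℝ) • v₂ = v₁
      rw [Subgroup.coe_mul, Subgroup.coe_inv, mul_smul, he, inv_smul_smul]
    have : δ₁ * (δ₁⁻¹ * δ₂) ∈ H := H.mul_mem h₁ (Subgroup.subset_closure hmem)
    simpa using this
  -- every point lies in some translate of `V`
  have hcovV : ∀ τ : ℍ, ∃ δ : Γ, τ ∈ (δ : GL (Fin 2) ℝ) • V := by
    intro τ
    obtain ⟨g, hg, hgτ⟩ := hcov τ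
    refine ⟨⟨g, hg⟩⁻¹, Set.mem_smul_set.mpr ⟨g • τ, hKV hgτ, ?_⟩⟩
    rw [Subgroup.coe_inv, Subgroup.coe_mk, inv_smul_smul]
  -- the two open sets
  set U₁ : Set ℍ := ⋃ δ ∈ {δ : Γ | δ ∈ H}, (δ : GL (Fin 2) ℝ) • V with hU₁
  set U₂ : Set ℍ := ⋃ δ ∈ {δ : Γ | δ ∉ H}, (δ : GL (Fin 2) ℝ) • V with hU₂
  have hU₁o : IsOpen U₁ := isOpen_biUnion fun δ _ => hVopen.smul _
  have hU₂o : IsOpen U₂ := isOpen_biUnion fun δ _ => hVopen.smul _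
  have hcover : (Set.univ : Set ℍ) ⊆ U₁ ∪ U₂ := by
    intro τ _
    obtain ⟨δ, hδ⟩ := hcovV τ
    by_cases h : δ ∈ H
    · exact Or.inl (Set.mem_biUnion (show δ ∈ {δ : Γ | δ ∈ H} from h) hδ)
    · exact Or.inr (Set.mem_biUnion (show δ ∈ {δ : Γ | δ ∉ H} from h) hδ)
  have hdisj : (Set.univ : Set ℍ) ∩ (U₁ ∩ U₂) = ∅ := by
    rw [Set.univ_inter, Set.eq_empty_iff_forall_notMem]
    rintro x ⟨hx₁, hx₂⟩
    simp only [hU₁, hU₂, Set.mem_iUnion, Set.mem_setOf_eq, exists_prop] at hx₁ hx₂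
    obtain ⟨δ₁, hδ₁, hxδ₁⟩ := hx₁
    obtain ⟨δ₂, hδ₂, hxδ₂⟩ := hx₂
    exact hδ₂ (key δ₁ δ₂ hδ₁ ⟨x, hxδ₁, hxδ₂⟩)
  have h1V : UpperHalfPlane.I ∈ ((1 : Γ) : GL (Fin 2) ℝ) • V := by
    rw [Subgroup.coe_one, one_smul]; exact hIV
  rcases (isPreconnected_iff_subset_of_disjoint.mp isPreconnected_univ) U₁ U₂ hU₁o hU₂o hcover
    hdisj with hall | hall
  · -- `ℍ = U₁`: every `γ` is in `H`
    rw [eq_top_iff]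
    intro γ _
    have hγI : (γ : GL (Fin 2) ℝ) • UpperHalfPlane.I ∈ U₁ := hall (Set.mem_univ _)
    simp only [hU₁, Set.mem_iUnion, Set.mem_setOf_eq, exists_prop] at hγI
    obtain ⟨δ, hδ, hγδ⟩ := hγI
    exact key δ γ hδ ⟨_, hγδ, Set.smul_mem_smul_set hIV⟩
  · -- `ℍ = U₂` is absurd: `I ∈ 1 • V` with `1 ∈ H`
    exfalso
    have hI : UpperHalfPlane.I ∈ U₂ := hall (Set.mem_univ _)
    simp only [hU₂, Set.mem_iUnion, Set.mem_setOf_eq, exists_prop] at hI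
    obtain ⟨δ, hδ, hIδ⟩ := hI
    exact hδ (key 1 δ H.one_mem ⟨_, h1V, hIδ⟩)

/-- **`Γ₀^D(M)` is finitely generated for `D > 1`** (Shimura Prop. 8.6 for the Fuchsian group
`ι(O¹)`): proper discontinuity (`properlyDiscontinuousSMul_Gamma`) and cocompactness
(`exists_forall_exists_smul_mem_closedBall`) of the tree. [cite: ShimuraIATAF1971, Prop. 8.6 (proof)] -/
theorem ShimuraCurveData.fg_Gamma {D M : ℕ} (X : ShimuraCurveData D M) (hD : 1 < D) :
    Group.FG X.Gamma := by
  haveI := X.properlyDiscontinuousSMul_Gamma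
  obtain ⟨ρ, hρ⟩ := X.exists_forall_exists_smul_mem_closedBall hD
  exact group_fg_of_isCompact_of_forall_exists_smul_mem (isCompact_closedBall _ _) hρ

end FiniteGeneration

/-! ### 2. The period homomorphism of a weight-two form -/

section Periods

variable {Γ : Subgroup (GL (Fin 2) ℝ)} [Γ.HasDetOne]

/-- Elements of `Γ ≤ SL₂(ℝ)` have positive determinant. [folklore] -/
theorem det_val_pos_of_mem {γ : GL (Fin 2) ℝ} (hγ : γ ∈ Γ) : 0 < γ.det.val := by
  rw [Subgroup.HasDetOne.det_eq hγ, Units.val_one]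
  exact one_pos

/-- **`Γ`-invariance of segment integrals**: `∫_{γz}^{γw} h = ∫_z^w h` for `h ∈ S₂(Γ)`, `γ ∈ Γ`
(`∫_{γz}^{γw} h = ∫_z^w h ∣[2] γ`, `segmentIntegral_slash_eq`, and `h ∣[2] γ = h`).
[cite: ShimuraIATAF1971, §8.2 (8.2.19)–(8.2.20)] -/
theorem segmentIntegral_smul_smul_of_mem (h : CuspForm Γ 2) {γ : GL (Fin 2) ℝ} (hγ : γ ∈ Γ)
    (z w : ℍ) : segmentIntegral h (γ • z) (γ • w) = segmentIntegral h z w := by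
  rw [← segmentIntegral_slash_eq h (det_val_pos_of_mem hγ) z w,
    SlashInvariantForm.slash_action_eqn h γ hγ]

/-- **The period `∫_τ^{γτ} h` does not depend on the base point `τ`** (`h ∈ S₂(Γ)`, `γ ∈ Γ`):
`∫_z^{γz} h − ∫_w^{γw} h = ∫_{γw}^{γz} h − ∫_w^z h = 0`. [cite: ShimuraIATAF1971, §8.2 (8.2.19)–(8.2.20)] -/
theorem period_eq_period (h : CuspForm Γ 2) {γ : GL (Fin 2) ℝ} (hγ : γ ∈ Γ) (z w : ℍ) :
    segmentIntegral h z (γ • z) = segmentIntegral h w (γ • w) := by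
  have e1 := segmentIntegral_sub_segmentIntegral h w z (γ • z)
  have e2 := segmentIntegral_sub_segmentIntegral h w (γ • w) (γ • z)
  have e3 := segmentIntegral_smul_smul_of_mem h hγ w z
  linear_combination (-1 : ℂ) * e1 + e2 + e3

omit [Γ.HasDetOne] in
/-- The period at `1` vanishes: `∫_z^z h = 0`. [folklore] -/
theorem period_one (h : CuspForm Γ 2) (z : ℍ) :
    segmentIntegral h z ((1 : GL (Fin 2) ℝ) • z) = 0 := by
  have e := segmentIntegral_sub_segmentIntegral h z z z
  rw [sub_self] at e
  rw [one_smul]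
  exact e.symm

/-- **Additivity of periods**: `∫_z^{γδz} h = ∫_z^{γz} h + ∫_z^{δz} h` for `γ ∈ Γ` (and any
`δ ∈ GL₂(ℝ)`) — on `Γ` the map `γ ↦ ∫_z^{γz} h` is a homomorphism `Γ → ℂ` (Shimura (8.2.20) with
`n = 0`: the cocycle of a weight-`2` form is a homomorphism). [cite: ShimuraIATAF1971, §8.2 (8.2.19)–(8.2.20)] -/
theorem period_mul (h : CuspForm Γ 2) {γ : GL (Fin 2) ℝ} (hγ : γ ∈ Γ) (δ : GL (Fin 2) ℝ) (z : ℍ) :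
    segmentIntegral h z ((γ * δ) • z) = segmentIntegral h z (γ • z) + segmentIntegral h z (δ • z) := by
  have e1 := segmentIntegral_sub_segmentIntegral h z (δ • z) ((γ * δ) • z)
  have e2 : segmentIntegral h (δ • z) ((γ * δ) • z) = segmentIntegral h z (γ • z) := by
    rw [mul_smul]
    exact (period_eq_period h hγ z (δ • z)).symm
  linear_combination e1 + e2

/-- Periods at inverses: `∫_z^{γ⁻¹z} h = −∫_z^{γz} h`. [folklore] -/
theorem period_inv (h : CuspForm Γ 2) {γ : GL (Fin 2) ℝ} (hγ : γ ∈ Γ) (z : ℍ) :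
    segmentIntegral h z (γ⁻¹ • z) = -segmentIntegral h z (γ • z) := by
  have e := period_mul h (inv_mem hγ) γ z
  rw [inv_mul_cancel, period_one] at e
  linear_combination -e

/-- **Periods from one base point**: if `∫_{τ₀}^{γτ₀} h ∈ Λ` for all `γ ∈ Γ` and one `τ₀`, then
`HasPeriodsIn Γ h Λ` (all base points; `period_eq_period`). [folklore] -/
theorem hasPeriodsIn_of_basePoint (h : CuspForm Γ 2) (Λ : Set ℂ) (τ₀ : ℍ)
    (H : ∀ γ ∈ Γ, segmentIntegral h τ₀ (γ • τ₀) ∈ Λ) : HasPeriodsIn Γ h Λ := by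
  intro γ hγ z
  rw [period_eq_period h hγ z τ₀]
  exact H γ hγ

/-- The primitive `Ψ = ∫_{τ₀}^τ h` transforms under `γ ∈ Γ` by the period:
`Ψ(γτ) = Ψ(τ) + ∫_{τ₀}^{γτ₀} h`. [cite: ShimuraIATAF1971, §8.2 (8.2.19)–(8.2.20)] -/
theorem segmentIntegral_smul_eq_add_period (h : CuspForm Γ 2) {γ : GL (Fin 2) ℝ} (hγ : γ ∈ Γ)
    (τ₀ τ : ℍ) :
    segmentIntegral h τ₀ (γ • τ) = segmentIntegral h τ₀ τ + segmentIntegral h τ₀ (γ • τ₀) := by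
  have e := segmentIntegral_sub_segmentIntegral h τ₀ τ (γ • τ)
  rw [period_eq_period h hγ τ τ₀] at e
  linear_combination e

/-! ### 3. Injectivity of the period map for cocompact `Γ` -/

/-- **A weight-two form with purely imaginary periods on a cocompact group vanishes** (Shimura
Thm. 8.4, injectivity of `S₂(Γ) → H¹(Γ, ℝ)`, `f ↦ Re ∫ f`). If a compact `K ⊆ ℍ` meets every
`Γ`-orbit and `Re ∫_{τ₀}^{γτ₀} h = 0` for all `γ ∈ Γ`, then `u = Re Ψ`, `Ψ = ∫_{τ₀}^τ h`, is a
`Γ`-invariant continuous function, hence attains a global maximum (on `K`); then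
`|exp Ψ| = exp u` has an interior maximum, `exp Ψ` is constant on `ℍ` (maximum modulus principle),
and `h = Ψ' = 0`. [cite: ShimuraIATAF1971, Thm. 8.4] -/
theorem coe_eq_zero_of_forall_re_period_eq_zero {K : Set ℍ} (hK : IsCompact K)
    (hcov : ∀ τ : ℍ, ∃ γ ∈ Γ, γ • τ ∈ K) (h : CuspForm Γ 2) (τ₀ : ℍ)
    (H : ∀ γ ∈ Γ, (segmentIntegral h τ₀ (γ • τ₀)).re = 0) : (⇑h : ℍ → ℂ) = 0 := by
  set Ψ : ℍ → ℂ := segmentIntegral h τ₀ with hΨdef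
  -- `Re Ψ` is `Γ`-invariant
  have hinv : ∀ γ ∈ Γ, ∀ τ : ℍ, (Ψ (γ • τ)).re = (Ψ τ).re := by
    intro γ hγ τ
    rw [hΨdef, segmentIntegral_smul_eq_add_period h hγ τ₀ τ, Complex.add_re, H γ hγ, add_zero]
  -- `Ψ` is holomorphic, continuous
  have hderiv : ∀ z : ℂ, 0 < z.im → HasDerivAt (Ψ ∘ ofComplex) (h (ofComplex z)) z :=
    fun z hz => hasDerivAt_segmentIntegral h τ₀ hz
  have hdiff : DifferentiableOn ℂ (Ψ ∘ ofComplex) {z : ℂ | 0 < z.im} :=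
    differentiableOn_segmentIntegral h τ₀
  have hΨc : Continuous Ψ := by
    have h2 : Ψ = (Ψ ∘ ofComplex) ∘ ((↑) : ℍ → ℂ) := by
      funext τ; simp [ofComplex_apply]
    rw [h2]
    exact hdiff.continuousOn.comp_continuous continuous_coe fun τ => τ.im_pos
  -- a global maximum of `Re Ψ`
  have hKne : K.Nonempty := by
    obtain ⟨γ, -, hγ⟩ := hcov UpperHalfPlane.I
    exact ⟨_, hγ⟩
  obtain ⟨k, hkK, hk⟩ := hK.exists_isMaxOn hKne (Complex.continuous_re.comp hΨc).continuousOn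
  have hmax : ∀ τ : ℍ, (Ψ τ).re ≤ (Ψ k).re := by
    intro τ
    obtain ⟨γ, hγ, hγτ⟩ := hcov τ
    rw [← hinv γ hγ τ]
    exact hk hγτ
  -- maximum modulus for `exp ∘ Ψ`
  set f : ℂ → ℂ := fun z => Complex.exp ((Ψ ∘ ofComplex) z) with hfdef
  have hfd : DifferentiableOn ℂ f {z : ℂ | 0 < z.im} := hdiff.cexp
  have hkU : (k : ℂ) ∈ {z : ℂ | 0 < z.im} := k.im_pos
  have hfmax : IsMaxOn (norm ∘ f) {z : ℂ | 0 < z.im} (k : ℂ) := by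
    intro z hz
    simp only [Function.comp_apply, hfdef, Complex.norm_exp, Set.mem_setOf_eq]
    refine Real.exp_le_exp.mpr ?_
    rw [ofComplex_apply, ofComplex_apply_of_im_pos hz]
    exact hmax _
  have hconst := Complex.eqOn_of_isPreconnected_of_isMaxOn_norm
    (convex_halfSpace_im_gt 0).isPreconnected isOpen_upperHalfPlaneSet hfd hkU hfmax
  -- differentiate the constant
  funext τ
  have hτ : 0 < (τ : ℂ).im := τ.im_pos
  have hd1 : HasDerivAt f (Complex.exp ((Ψ ∘ ofComplex) (τ : ℂ)) * h (ofComplex (τ : ℂ))) (τ : ℂ) :=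
    (hderiv (τ : ℂ) hτ).cexp
  have hd2 : HasDerivAt f 0 (τ : ℂ) := by
    have hev : f =ᶠ[𝓝 (τ : ℂ)] fun _ => f (k : ℂ) :=
      Filter.eventuallyEq_of_mem (isOpen_upperHalfPlaneSet.mem_nhds hτ) hconst
    exact (hasDerivAt_const (τ : ℂ) (f (k : ℂ))).congr_of_eventuallyEq hev
  have h0 := hd1.unique hd2
  rw [ofComplex_apply] at h0
  rcases mul_eq_zero.mp h0 with h1 | h1
  · exact absurd h1 (Complex.exp_ne_zero _)
  · simpa using h1

/-- The same with all periods `= 0` (complex). [cite: ShimuraIATAF1971, Thm. 8.4] -/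
theorem coe_eq_zero_of_forall_period_eq_zero {K : Set ℍ} (hK : IsCompact K)
    (hcov : ∀ τ : ℍ, ∃ γ ∈ Γ, γ • τ ∈ K) (h : CuspForm Γ 2) (τ₀ : ℍ)
    (H : ∀ γ ∈ Γ, segmentIntegral h τ₀ (γ • τ₀) = 0) : (⇑h : ℍ → ℂ) = 0 :=
  coe_eq_zero_of_forall_re_period_eq_zero hK hcov h τ₀ fun γ hγ => by rw [H γ hγ, Complex.zero_re]

/-- Segment integrals of a difference of cusp forms (through primitives; no integrability
bookkeeping). [folklore] -/
theorem segmentIntegral_coe_sub {Γ' : Subgroup (GL (Fin 2) ℝ)} (h₁ h₂ : CuspForm Γ' 2) (z w : ℍ) :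
    segmentIntegral (⇑(h₁ - h₂)) z w = segmentIntegral h₁ z w - segmentIntegral h₂ z w := by
  obtain ⟨F₁, hF₁⟩ := exists_hasDerivAt_primitive h₁
  obtain ⟨F₂, hF₂⟩ := exists_hasDerivAt_primitive h₂
  have hF : ∀ u : ℂ, 0 < u.im → HasDerivAt (F₁ - F₂) ((h₁ - h₂) (ofComplex u)) u :=
    fun u hu => ((hF₁ u hu).sub (hF₂ u hu)).congr_deriv (by simp)
  rw [segmentIntegral_eq_sub (h₁ - h₂) hF, segmentIntegral_eq_sub h₁ hF₁,
    segmentIntegral_eq_sub h₂ hF₂]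
  simp only [Pi.sub_apply]
  ring

/-- **The real-period map is injective on `S₂(Γ)` for cocompact `Γ`**: two cusp forms whose periods
have the same real parts coincide. [cite: ShimuraIATAF1971, Thm. 8.4] -/
theorem eq_of_forall_re_period_eq {K : Set ℍ} (hK : IsCompact K)
    (hcov : ∀ τ : ℍ, ∃ γ ∈ Γ, γ • τ ∈ K) (h₁ h₂ : CuspForm Γ 2) (τ₀ : ℍ)
    (H : ∀ γ ∈ Γ, (segmentIntegral h₁ τ₀ (γ • τ₀)).re = (segmentIntegral h₂ τ₀ (γ • τ₀)).re) :
    h₁ = h₂ := by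
  have h0 := coe_eq_zero_of_forall_re_period_eq_zero hK hcov (h₁ - h₂) τ₀ fun γ hγ => by
    rw [segmentIntegral_coe_sub, Complex.sub_re, H γ hγ, sub_self]
  rw [← sub_eq_zero]
  exact DFunLike.coe_injective (h0.trans CuspForm.coe_zero.symm)

end Periods

/-! ### 3′. Specialisation to `Γ₀^D(M)`, `D > 1` -/

namespace ShimuraCurveData

variable {D M : ℕ} (X : ShimuraCurveData D M)

/-- **On `X₀^D(M)` (`D > 1`) a cusp form with purely imaginary periods is zero** (cocompactness of
`Γ₀^D(M)`, `exists_forall_exists_smul_mem_closedBall`). [cite: ShimuraIATAF1971, Thm. 8.4] -/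
theorem coe_eq_zero_of_forall_re_period_eq_zero (hD : 1 < D) (h : CuspForm X.Gamma 2) (τ₀ : ℍ)
    (H : ∀ γ ∈ X.Gamma, (segmentIntegral h τ₀ (γ • τ₀)).re = 0) : (⇑h : ℍ → ℂ) = 0 := by
  obtain ⟨ρ, hρ⟩ := X.exists_forall_exists_smul_mem_closedBall hD
  exact Automorphic.coe_eq_zero_of_forall_re_period_eq_zero (isCompact_closedBall _ _) hρ h τ₀ H

/-- A non-zero cusp form on `X₀^D(M)` (`D > 1`) has a non-zero period. [cite: ShimuraIATAF1971, Thm. 8.4] -/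
theorem exists_period_ne_zero (hD : 1 < D) (h : CuspForm X.Gamma 2) (hh : (⇑h : ℍ → ℂ) ≠ 0)
    (τ₀ : ℍ) : ∃ γ ∈ X.Gamma, segmentIntegral h τ₀ (γ • τ₀) ≠ 0 := by
  by_contra hc
  simp only [not_exists, not_and, not_not] at hc
  obtain ⟨ρ, hρ⟩ := X.exists_forall_exists_smul_mem_closedBall hD
  exact hh (coe_eq_zero_of_forall_period_eq_zero (isCompact_closedBall _ _) hρ h τ₀ hc)

/-! ### 4. Hecke stability of period groups -/

/-- **Hecke operators preserve period groups** (Shimura §8.3, (8.3.2): for coset representatives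
`Γ \ ι(O(n)) = {Γ αᵢ}` and `γ ∈ Γ` write `αᵢ γ = δᵢ α_{σ(i)}` with `δᵢ ∈ Γ`, `σ` a permutation; then
the period of `T_n h = Σᵢ h ∣[2] αᵢ` at `γ` is `Σᵢ (period of h at δᵢ)`). Hence if all periods
`∫_z^{γz} h`, `γ ∈ Γ₀^D(M)`, lie in an additive subgroup `Λ ⊆ ℂ`, so do all periods of `T_n h`
(`D > 1`, every `n`). Proof with a holomorphic primitive `H` of `h`: `Σᵢ H(αᵢ τ)` is a primitive of
`T_n h`, and `Σᵢ [H(αᵢγz) − H(αᵢz)] = Σᵢ [H(δᵢ α_{σ i} z) − H(α_{σ i} z)] = Σᵢ ∫_{cᵢ}^{δᵢ cᵢ} h ∈ Λ`.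
[cite: ShimuraIATAF1971, §8.3 (8.3.2)] -/
theorem hasPeriodsIn_heckeFun (hD : 1 < D) (n : ℕ) (h : CuspForm X.Gamma 2) (Λ : AddSubgroup ℂ)
    (hper : HasPeriodsIn X.Gamma h (Λ : Set ℂ)) :
    HasPeriodsIn X.Gamma (X.heckeFun n h) (Λ : Set ℂ) := by
  classical
  haveI := X.finite_quotient_heckeSetoid hD n
  letI : Fintype (Quotient (X.heckeSetoid n)) := Fintype.ofFinite _
  obtain ⟨T, hT⟩ := X.exists_cuspForm_coe_eq_heckeFun hD n h
  obtain ⟨H, hH⟩ := exists_hasDerivAt_primitive h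
  set α : Quotient (X.heckeSetoid n) → GL (Fin 2) ℝ :=
    fun q => ((q.out : X.heckeSet n) : GL (Fin 2) ℝ) with hαdef
  have hαmem : ∀ q, α q ∈ X.heckeSet n := fun q => (q.out : X.heckeSet n).2
  have hαdet : ∀ q, 0 < (α q).det.val := fun q => X.det_pos_of_mem_heckeSet (hαmem q)
  -- a primitive of `T_n h`
  have hG : ∀ u : ℂ, 0 < u.im →
      HasDerivAt (fun v : ℂ => ∑ q, H ((α q • ofComplex v : ℍ) : ℂ)) (T (ofComplex u)) u := by
    intro u hu
    have hs := HasDerivAt.fun_sum (u := Finset.univ)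
      (A := fun q => fun v : ℂ => H ((α q • ofComplex v : ℍ) : ℂ))
      (A' := fun q => (⇑h ∣[(2 : ℤ)] α q) (ofComplex u)) (x := u)
      (fun q _ => hasDerivAt_comp_smul_of_hasDerivAt h (hαdet q) hH hu)
    have e : T (ofComplex u) = ∑ q, (⇑h ∣[(2 : ℤ)] α q) (ofComplex u) := by
      rw [hT, X.heckeFun_eq_sum, Finset.sum_apply]
    rw [e]
    exact hs
  intro γ hγ z
  -- right multiplication by `γ` permutes the cosets
  let ρ : X.heckeSet n → X.heckeSet n := fun a => ⟨a * γ, X.mul_mem_heckeSet a.2 hγ⟩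
  let ρ' : X.heckeSet n → X.heckeSet n := fun a => ⟨a * γ⁻¹, X.mul_mem_heckeSet a.2 (inv_mem hγ)⟩
  have hρ : ∀ a b : X.heckeSet n, (X.heckeSetoid n) a b → (X.heckeSetoid n) (ρ a) (ρ b) := by
    rintro a b ⟨δ, hδ, hab⟩
    exact ⟨δ, hδ, by simp only [ρ, ← mul_assoc, hab]⟩
  have hρ' : ∀ a b : X.heckeSet n, (X.heckeSetoid n) a b → (X.heckeSetoid n) (ρ' a) (ρ' b) := by
    rintro a b ⟨δ, hδ, hab⟩
    exact ⟨δ, hδ, by simp only [ρ', ← mul_assoc, hab]⟩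
  let e : Quotient (X.heckeSetoid n) ≃ Quotient (X.heckeSetoid n) :=
    { toFun := Quotient.map ρ hρ
      invFun := Quotient.map ρ' hρ'
      left_inv := fun q => Quotient.inductionOn q fun a => by
        simp only [Quotient.map_mk]
        refine congrArg _ (Subtype.ext ?_)
        simp only [ρ, ρ', mul_inv_cancel_right]
      right_inv := fun q => Quotient.inductionOn q fun a => by
        simp only [Quotient.map_mk]
        refine congrArg _ (Subtype.ext ?_)
        simp only [ρ, ρ', inv_mul_cancel_right] }
  have he : ∀ q, e q = Quotient.map ρ hρ q := fun q => rfl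
  have hδex : ∀ q : Quotient (X.heckeSetoid n), ∃ δ ∈ X.Gamma, α q * γ = δ * α (e q) := by
    intro q
    have h1 : e q = Quotient.mk _ (ρ q.out) := by
      conv_lhs => rw [he, ← Quotient.out_eq q]
      rfl
    have h2 : (X.heckeSetoid n) (e q).out (ρ q.out) := Quotient.exact (((e q).out_eq).trans h1)
    obtain ⟨δ, hδ, hδeq⟩ := h2
    exact ⟨δ, hδ, hδeq.symm⟩
  choose δ hδ hδeq using hδex
  -- compute the period of `T_n h` at `γ`
  rw [← hT, segmentIntegral_eq_sub T hG z (γ • z)]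
  simp only [ofComplex_apply]
  have hsplit : ∀ q, H ((α q • γ • z : ℍ) : ℂ) =
      H ((α (e q) • z : ℍ) : ℂ) + segmentIntegral h (α (e q) • z) (δ q • α (e q) • z) := by
    intro q
    rw [segmentIntegral_eq_sub h hH, ← mul_smul, hδeq q, mul_smul]
    ring
  have hsum : ((∑ q, H ((α q • γ • z : ℍ) : ℂ)) - ∑ q, H ((α q • z : ℍ) : ℂ)) =
      ∑ q, segmentIntegral h (α (e q) • z) (δ q • α (e q) • z) := by
    simp_rw [hsplit, Finset.sum_add_distrib]
    rw [Equiv.sum_comp e (fun q => H ((α q • z : ℍ) : ℂ))]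
    ring
  rw [hsum]
  exact Λ.sum_mem fun q _ => hper (δ q) (hδ q) _

/-- Hecke stability of the period condition of a parametrisation datum: in a
`ShimuraParametrizationData X W` with `D > 1`, every `T_n form` again has periods in `Λ_L` (not only
the `T_ℓ`, `ℓ ∤ D M`, for which it is `a_ℓ(W) · form`). [cite: ShimuraIATAF1971, §8.3 (8.3.2)] -/
theorem _root_.Literature.NumberTheory.Automorphic.ShimuraParametrizationData.hasPeriodsIn_heckeFun_form
    {W : WeierstrassCurve ℚ} (P : ShimuraParametrizationData X W) (hD : 1 < D) (n : ℕ) :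
    HasPeriodsIn X.Gamma (X.heckeFun n P.form) (P.L.lattice : Set ℂ) :=
  X.hasPeriodsIn_heckeFun hD n P.form P.L.lattice.toAddSubgroup P.period_mem

/-! ### 5. Integrality of Hecke eigenvalues on `S₂^D(M)` -/

/-- **The period group of a cusp form on `X₀^D(M)` is finitely generated** (`D > 1`): it is
generated by the periods at a finite set of generators of `Γ₀^D(M)` (`fg_Gamma`, `period_mul`,
`period_inv`). Stated as: there is a finitely generated `ℤ`-submodule `N ⊆ ℂ` containing every
period and generated by periods. [cite: ShimuraIATAF1971, Prop. 8.6 (proof)] -/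
theorem fg_span_periods (hD : 1 < D) (h : CuspForm X.Gamma 2) (τ₀ : ℍ) :
    (Submodule.span ℤ {p | ∃ γ ∈ X.Gamma, p = segmentIntegral h τ₀ (γ • τ₀)}).FG := by
  classical
  obtain ⟨S, hS, hSfin⟩ := Group.fg_iff.mp (X.fg_Gamma hD)
  set per : X.Gamma → ℂ := fun γ => segmentIntegral h τ₀ ((γ : GL (Fin 2) ℝ) • τ₀) with hperdef
  -- the span of all periods is the span of the periods at the generators
  suffices heq : Submodule.span ℤ {p | ∃ γ ∈ X.Gamma, p = segmentIntegral h τ₀ (γ • τ₀)} =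
      Submodule.span ℤ (per '' S) by
    rw [heq]
    exact Submodule.fg_span (hSfin.image per)
  apply le_antisymm
  · refine Submodule.span_le.mpr ?_
    rintro _ ⟨γ, hγ, rfl⟩
    have hγS : (⟨γ, hγ⟩ : X.Gamma) ∈ Subgroup.closure S := by rw [hS]; trivial
    suffices hp : per ⟨γ, hγ⟩ ∈ Submodule.span ℤ (per '' S) by simpa [hperdef] using hp
    refine Subgroup.closure_induction (p := fun x _ => per x ∈ Submodule.span ℤ (per '' S))
      (fun s hs => Submodule.subset_span ⟨s, hs, rfl⟩) ?_ ?_ ?_ hγS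
    · show segmentIntegral h τ₀ (((1 : X.Gamma) : GL (Fin 2) ℝ) • τ₀) ∈ _
      rw [Subgroup.coe_one, period_one]
      exact Submodule.zero_mem _
    · intro x y _ _ hx hy
      show segmentIntegral h τ₀ (((x * y : X.Gamma) : GL (Fin 2) ℝ) • τ₀) ∈ _
      rw [Subgroup.coe_mul, period_mul h x.2]
      exact Submodule.add_mem _ hx hy
    · intro x _ hx
      show segmentIntegral h τ₀ (((x⁻¹ : X.Gamma) : GL (Fin 2) ℝ) • τ₀) ∈ _
      rw [Subgroup.coe_inv, period_inv h x.2]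
      exact Submodule.neg_mem _ hx
  · refine Submodule.span_mono ?_
    rintro _ ⟨s, -, rfl⟩
    exact ⟨s, s.2, rfl⟩

/-- **Hecke eigenvalues on `S₂^D(M)` are algebraic integers** (`D > 1`; Pasten §4.9: the systems
of Hecke eigenvalues `χ : 𝕋_{D,M} → ℂ` take values "in the ring of integers of a totally real
number field" — here the integrality of each `χ(T_n)`; reality is `conj_eq_of_heckeFun_eq_mul`).
If `T_n h = a · h` with `h ≠ 0`, the period group `N` of `h` is a finitely generated `ℤ`-module
(`exists_fg_submodule_periods`), non-zero (`exists_period_ne_zero`), and `a N ⊆ N` because the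
periods of `T_n h = a h` are `a` times those of `h` and lie in `N` (`hasPeriodsIn_heckeFun`); so
`a` is integral over `ℤ` (Mathlib `isIntegral_of_smul_mem_submodule`). This is Shimura's route
through `H¹(Γ, ℤ)` (Ch. 8) rather than through `q`-expansions, which do not exist for `D > 1`.
[cite: PastenShimura2024, §4.9 p. 15] [cite: ShimuraIATAF1971, §8.3 and Prop. 8.6] -/
theorem isIntegral_of_heckeFun_eq_mul (hD : 1 < D) {n : ℕ} {h : CuspForm X.Gamma 2}
    (hh : (⇑h : ℍ → ℂ) ≠ 0) {a : ℂ} (ha : X.heckeFun n h = fun τ => a * h τ) :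
    IsIntegral ℤ a := by
  classical
  set τ₀ : ℍ := UpperHalfPlane.I
  set N : Submodule ℤ ℂ :=
    Submodule.span ℤ {p | ∃ γ ∈ X.Gamma, p = segmentIntegral h τ₀ (γ • τ₀)} with hNdef
  have hNfg : N.FG := X.fg_span_periods hD h τ₀
  have hNper : ∀ γ ∈ X.Gamma, segmentIntegral h τ₀ (γ • τ₀) ∈ N :=
    fun γ hγ => Submodule.subset_span ⟨γ, hγ, rfl⟩
  -- the periods of `h` lie in `N`, hence so do those of `T_n h = a h`
  have hper : HasPeriodsIn X.Gamma h (N.toAddSubgroup : Set ℂ) :=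
    hasPeriodsIn_of_basePoint h _ τ₀ hNper
  have hTper := X.hasPeriodsIn_heckeFun hD n h N.toAddSubgroup hper
  rw [ha] at hTper
  have hstab_gen : ∀ γ ∈ X.Gamma, a * segmentIntegral h τ₀ (γ • τ₀) ∈ N := by
    intro γ hγ
    have := hTper γ hγ τ₀
    rwa [segmentIntegral_const_mul] at this
  -- `a • N ⊆ N`
  have hstab : ∀ x ∈ N, a • x ∈ N := by
    intro x hx
    refine Submodule.span_induction (p := fun x _ => a • x ∈ N) ?_ ?_ ?_ ?_ hx
    · rintro _ ⟨γ, hγ, rfl⟩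
      rw [smul_eq_mul]
      exact hstab_gen γ hγ
    · rw [smul_zero]; exact N.zero_mem
    · intro x y _ _ hpx hpy
      rw [smul_add]; exact N.add_mem hpx hpy
    · intro m x _ hpx
      rw [smul_comm]; exact N.smul_mem m hpx
  -- `N ≠ ⊥`
  have hN0 : N ≠ ⊥ := by
    obtain ⟨γ, hγ, hne⟩ := X.exists_period_ne_zero hD h hh τ₀
    intro hbot
    apply hne
    have := hNper γ hγ
    rw [hbot, Submodule.mem_bot] at this
    exact this
  exact isIntegral_of_smul_mem_submodule N hN0 hNfg a hstab

/-- **Hecke eigenvalues on `S₂^D(M)` are real algebraic integers** (`D > 1`): integrality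
(`isIntegral_of_heckeFun_eq_mul`) together with reality (the tree's `conj_eq_of_heckeFun_eq_mul`,
self-adjointness for the Petersson product) — the two halves of Pasten §4.9 "`χ` takes values in
the ring of integers of a totally real number field" that concern a single eigenvalue.
[cite: PastenShimura2024, §4.9 p. 15] -/
theorem isIntegral_and_conj_eq_of_heckeFun_eq_mul (hD : 1 < D) {n : ℕ} {h : CuspForm X.Gamma 2}
    (hh : (⇑h : ℍ → ℂ) ≠ 0) {a : ℂ} (ha : X.heckeFun n h = fun τ => a * h τ) :
    IsIntegral ℤ a ∧ (starRingEnd ℂ) a = a :=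
  ⟨X.isIntegral_of_heckeFun_eq_mul hD hh ha, X.conj_eq_of_heckeFun_eq_mul hD hh ha⟩

/-- **Rational Hecke eigenvalues on `S₂^D(M)` are integers** (`D > 1`): `ℤ` is integrally closed.
In particular the eigenvalues asked of a form in the Hecke line of an elliptic curve `W/ℚ` — the
`a_ℓ(W) ∈ ℤ` of `ShimuraParametrizationData.hecke_eq` — are the only rational ones possible.
[cite: PastenShimura2024, §4.9 p. 15] -/
theorem exists_intCast_eq_of_heckeFun_eq_mul (hD : 1 < D) {n : ℕ} {h : CuspForm X.Gamma 2}
    (hh : (⇑h : ℍ → ℂ) ≠ 0) {q : ℚ} (hq : X.heckeFun n h = fun τ => (q : ℂ) * h τ) :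
    ∃ m : ℤ, (m : ℚ) = q := by
  have hint : IsIntegral ℤ (q : ℂ) := X.isIntegral_of_heckeFun_eq_mul hD hh hq
  have hint' : IsIntegral ℤ q := by
    have e : (q : ℂ) = algebraMap ℚ ℂ q := rfl
    rw [e] at hint
    exact (isIntegral_algebraMap_iff (algebraMap ℚ ℂ).injective).mp hint
  obtain ⟨m, hm⟩ := IsIntegrallyClosed.isIntegral_iff.mp hint'
  exact ⟨m, by simpa using hm⟩

/-- **Systems of Hecke eigenvalues with real algebraic-integer values exist on `S₂^D(M) ≠ 0`**
(`D > 1`): there is a non-zero simultaneous eigenform of all the `T_p` (the tree's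
`exists_simultaneous_heckeFun_eigenform`: commutativity for coprime indices and self-adjointness)
whose eigenvalues are real (by construction) algebraic integers (`isIntegral_of_heckeFun_eq_mul`) —
Pasten §4.9: the action of `𝕋_{D,M}` "is simultaneously diagonalizable, which gives rise to systems
of Hecke eigenvalues `χ` … Such a `χ` takes values in the ring of integers of a totally real number
field" (here: each `χ(T_p)` a real algebraic integer). [cite: PastenShimura2024, §4.9 p. 15] -/
theorem exists_simultaneous_heckeFun_eigenform_isIntegral (hD : 1 < D) (hM : 0 < M)
    [Nontrivial (CuspForm X.Gamma 2)] :
    ∃ (g : CuspForm X.Gamma 2) (ev : ℕ → ℝ), (⇑g : ℍ → ℂ) ≠ 0 ∧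
      (∀ p : ℕ, p.Prime → X.heckeFun p g = fun τ => (ev p : ℂ) * g τ) ∧
      ∀ p : ℕ, p.Prime → IsIntegral ℤ (ev p : ℂ) := by
  obtain ⟨g, ev, hg, hev⟩ := X.exists_simultaneous_heckeFun_eigenform hD hM
  exact ⟨g, ev, hg, hev, fun p hp => X.isIntegral_of_heckeFun_eq_mul hD hg (hev p hp)⟩

end ShimuraCurveData

end Literature.NumberTheory.Automorphic
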